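import Summits.Ventures.PercRepro2.CaseOneDWorldOdds
import Summits.Ventures.PercRepro2.CaseOneDegTwo
import Summits.Ventures.PercRepro2.CaseOneDWorldIEdge

/-!
# Identity (L) for `(i)`, the degree-2 reduction for `(i)`, and `(i)` for the roots-and-`b`
class (blind cell PercRepro2, p1 g19; S5 §2.1 (K9) (a) completed on the `(i)` side)

The `(i)` mirror of `CaseOneDWorldLeaf` / `CaseOneDWorldOdds` / `CaseOneDegTwo`. For `a₃` a leaf at
`v` in the support of `p` (`IsLeafSupp`), the event `{b ∈ C₁}` ignores the leaf edge (`b ≠ a₃`), so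
the D-world `(i)` of `a₃` is the `r`-mixture of the Q-world and the D-world `(i)` of `v` in `G − a₃`
(`iExprD_leaf_supp`: `iExprD p (a₃) = r [(1 − r) iExprT p′ (v) + r iExprD p′ (v)]`,
`p′ = p[e₀ ↦ 0]`),
and with the odds condition at the mixed pair (`odds_mix`) the D-world `(i)` of `v` at the PD pair
of `a₃` gives `ZSplitID` of `a₃` (`zSplitID_of_leaf_supp`). Since the root edges at `a₃` are free
(`zSplitID_of_rootFree`), **`zSplitID_of_rootsAndLeaf`**: for `a₃` adjacent to the roots (any
multiplicities) and to one further vertex `v`, `ZSplitID` follows from the D-world `(i)` of `v` at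
the PD pair of `a₃` (every weight vector with the root edges null); the two marked neighbours are
unconditional — `iExprD_nonneg_of_a3_eq_o` (BHK for the cluster of `a₁` under `a₂ ↮ {a₁, o}`) and
`iExprD_nonneg_of_a3_eq_b` (the odds condition). Hence **`zSplitI_of_rootsAndB`** and
**`jOneOne_of_rootsAndB`**: `(i)` and `(J1₁)` for `a₃` adjacent to the roots and to `b`, every
finite graph, every weight vector — the row «roots + one edge to `o`, resp. to `b`» of S5 is closed
on all of `(ii)`, `(i)`, `(J1₁)`; and **Theorem D2 for `(i)`** (`zSplitI_of_degTwo`, `_o`, `_b`).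
Own code; standard axioms.
-/

namespace Summit.Ventures.PercRepro2

namespace CaseOne

/-! ## The `b ∈ C₁`-masses of a leaf in the support -/

section Masses
variable {V : Type*} {E : Type*} [Fintype E] [DecidableEq E] {R : Type*} [CommRing R]
variable {p : E → R} {ends : E → Sym2 V} {v a₃ : V} {e₀ : E}

omit [Fintype E] in
/-- The `a₁`-connection of a vertex `≠ a₃` ignores `e₀` on good configurations. -/
lemma a1_conn_good (hl : IsLeafSupp p ends v a₃ e₀) {a₁ x : V} (h1 : a₁ ≠ a₃) (hx : x ≠ a₃) :
    ∀ ω, Good ends a₃ e₀ ω → (Function.update ω e₀ true ∈ connEvent ends a₁ x ↔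
      Function.update ω e₀ false ∈ connEvent ends a₁ x) :=
  fun ω hω => by simp only [mem_connEvent]; exact (good_facts hl hω).1 a₁ x h1 hx

/-- **`P(D(a₃), b ∈ C₁) = r P'(D(v), b ∈ C₁) + (1 − r) P'(Q, b ∈ C₁)`.** -/
theorem prob_B1_Dw_leaf_supp (hl : IsLeafSupp p ends v a₃ e₀) {a₁ a₂ b : V} (h1 : a₁ ≠ a₃)
    (h2 : a₂ ≠ a₃) (hb : b ≠ a₃) :
    prob p (connEvent ends a₁ b ∩ Dw ends a₁ a₂ a₃) =
      p e₀ * prob (Function.update p e₀ 0) (connEvent ends a₁ b ∩ Dw ends a₁ a₂ v) +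
      (1 - p e₀) *
        prob (Function.update p e₀ 0) (connEvent ends a₁ b ∩ (connEvent ends a₁ a₂)ᶜ) := by
  refine prob_pin_supp hl _ _ _ (fun ω hω => ?_) (fun ω hω => ?_)
  · obtain ⟨f0, f1, _⟩ := good_facts hl hω
    simp only [Dw, Set.mem_inter_iff, Set.mem_compl_iff, mem_connEvent]
    rw [f0 a₁ a₂ h1 h2, f1 a₂ h2, f0 a₁ b h1 hb]
  · obtain ⟨_, _, f2⟩ := good_facts hl hω
    simp only [Dw, Set.mem_inter_iff, Set.mem_compl_iff, mem_connEvent]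
    exact ⟨fun h => ⟨h.1, h.2.1⟩, fun h => ⟨h.1, h.2, f2 a₂ h2⟩⟩

/-- **Identity (L) for `(i)`**: for `a₃` a leaf at `v` in the support, with `r = p(e₀)` and
`p' = p[e₀ ↦ 0]`,
`iExprD p (a₃; c₀, c₁) = r · [(1 − r) · iExprT p' (v; c₀, c₁) + r · iExprD p' (v; c₀, c₁)]`. -/
theorem iExprD_leaf_supp (hl : IsLeafSupp p ends v a₃ e₀) {o a₁ a₂ b : V} (ho : o ≠ a₃)
    (h1 : a₁ ≠ a₃) (h2 : a₂ ≠ a₃) (hb : b ≠ a₃) (c₀ c₁ : R) :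
    iExprD p ends o a₁ a₂ a₃ b c₀ c₁ =
      p e₀ * ((1 - p e₀) * iExprT (Function.update p e₀ 0) ends o a₁ a₂ v b c₀ c₁ +
        p e₀ * iExprD (Function.update p e₀ 0) ends o a₁ a₂ v b c₀ c₁) := by
  rw [iExprD_eq, iExprT_eq, iExprD_eq, prob_Dw_leaf_supp hl h1 h2,
    prob_B1_Dw_leaf_supp hl h1 h2 hb]
  have hB := a1_conn_good hl h1 hb
  have hO := a2_conn_good hl h2 ho
  have e1 : connEvent ends a₁ b ∩ connEvent ends a₁ a₃ ∩ connEvent ends a₂ o ∩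
      (connEvent ends a₁ a₂)ᶜ =
      (connEvent ends a₁ b ∩ connEvent ends a₂ o) ∩ connEvent ends a₁ a₃ ∩
        (connEvent ends a₁ a₂)ᶜ := by
    ext ω; simp only [Set.mem_inter_iff]; tauto
  have e1' : connEvent ends a₁ b ∩ connEvent ends a₁ v ∩ connEvent ends a₂ o ∩
      (connEvent ends a₁ a₂)ᶜ =
      (connEvent ends a₁ b ∩ connEvent ends a₂ o) ∩ connEvent ends a₁ v ∩
        (connEvent ends a₁ a₂)ᶜ := by
    ext ω; simp only [Set.mem_inter_iff]; tauto
  have e2 : connEvent ends a₁ a₃ ∩ connEvent ends a₂ o ∩ (connEvent ends a₁ a₂)ᶜ =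
      connEvent ends a₂ o ∩ connEvent ends a₁ a₃ ∩ (connEvent ends a₁ a₂)ᶜ := by
    ext ω; simp only [Set.mem_inter_iff]; tauto
  have e2' : connEvent ends a₁ v ∩ connEvent ends a₂ o ∩ (connEvent ends a₁ a₂)ᶜ =
      connEvent ends a₂ o ∩ connEvent ends a₁ v ∩ (connEvent ends a₁ a₂)ᶜ := by
    ext ω; simp only [Set.mem_inter_iff]; tauto
  have hBAO := prob_A_leaf_supp hl h1 h2 _ (inter_good hB hO)
  have hAO := prob_A_leaf_supp hl h1 h2 _ hO
  have hBA := prob_A_leaf_supp hl h1 h2 _ hB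
  have hA := prob_A_leaf_supp hl h1 h2 Set.univ (fun _ _ => by simp)
  rw [Set.univ_inter, Set.univ_inter] at hA
  rw [e1, e2, hBAO, hAO, hBA, hA, ← e1', ← e2']
  ring

end Masses

/-! ## The pendant step and the bases -/

section Theorem
variable {V : Type*} {E : Type*} [Fintype E] [DecidableEq E] [Fintype V] [DecidableEq V]
  {R : Type*} [Field R] [LinearOrder R] [IsStrictOrderedRing R]
variable {p : E → R} {ends : E → Sym2 V} {v a₃ : V} {e₀ : E}

/-- **The pendant step for `(i)`**: if `a₃` is a leaf at `v` in the support of `p` and the D-world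
`(i)` of `v` (in `G − a₃`, weights `p[e₀ ↦ 0]`) holds at the PD pair of `a₃`, then
`ZSplitID p (a₃)`. -/
theorem zSplitID_of_leaf_supp (hp : IsProbVec p) (hl : IsLeafSupp p ends v a₃ e₀)
    {o a₁ a₂ b : V} (ho : o ≠ a₃) (h1 : a₁ ≠ a₃) (h2 : a₂ ≠ a₃) (hb : b ≠ a₃)
    (hv : 0 ≤ iExprD (Function.update p e₀ 0) ends o a₁ a₂ v b (Dpdo p ends o a₁ a₂ a₃)
      (Dpd p ends a₁ a₂ a₃)) :
    ZSplitID p ends o a₁ a₂ a₃ b := by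
  unfold ZSplitID
  rw [iExprD_leaf_supp hl ho h1 h2 hb]
  have hp' : IsProbVec (Function.update p e₀ 0) := hp.update e₀ le_rfl zero_le_one
  have hr0 : 0 ≤ p e₀ := hp.nonneg e₀
  have hr1 : 0 ≤ 1 - p e₀ := by linarith [hp.le_one e₀]
  have hodds : Dpd p ends a₁ a₂ a₃ * prob (Function.update p e₀ 0)
      (connEvent ends a₁ v ∩ connEvent ends a₂ o ∩ (connEvent ends a₁ a₂)ᶜ) ≤
      Dpdo p ends o a₁ a₂ a₃ * prob (Function.update p e₀ 0)
        (connEvent ends a₁ v ∩ (connEvent ends a₁ a₂)ᶜ) := by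
    rw [Dpd_leaf_supp hl h1 h2, Dpdo_leaf_supp hl ho h1 h2]
    exact odds_mix (Function.update p e₀ 0) hp' ends o a₁ a₂ v (p e₀) hr0 (hp.le_one e₀)
  have hT := iExprT_nonneg_of_dworld (Function.update p e₀ 0) hp' ends o a₁ a₂ v b _ _ hv hodds
  exact mul_nonneg hr0 (add_nonneg (mul_nonneg hr1 hT) (mul_nonneg hr0 hv))

omit [Fintype V] [DecidableEq V] in
/-- **Base case `a₃ = b`**: `0 ≤ iExprD` whenever `c₁ P(Q, b ∈ C₁, o ∈ C₂) ≤ c₀ P(Q, b ∈ C₁)`. -/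
theorem iExprD_nonneg_of_a3_eq_b (p : E → R) (hp : IsProbVec p) (ends : E → Sym2 V)
    (o a₁ a₂ b : V) (c₀ c₁ : R)
    (hodds : c₁ * prob p (connEvent ends a₁ b ∩ connEvent ends a₂ o ∩ (connEvent ends a₁ a₂)ᶜ) ≤
      c₀ * prob p (connEvent ends a₁ b ∩ (connEvent ends a₁ a₂)ᶜ)) :
    0 ≤ iExprD p ends o a₁ a₂ b b c₀ c₁ := by
  rw [iExprD_eq, Set.inter_self]
  have hBD : prob p (connEvent ends a₁ b ∩ Dw ends a₁ a₂ b) ≤ prob p (Dw ends a₁ a₂ b) :=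
    prob_mono hp Set.inter_subset_right
  have := mul_nonneg (sub_nonneg.2 hBD) (sub_nonneg.2 hodds)
  linarith [this]

/-- **Base case `a₃ = o`**: `0 ≤ iExprD` for every pair with `0 ≤ c₀` — the `o ∈ C₂` masses vanish
and `{b ∈ C₁}`, `{o ∈ C₁}` are positively associated under `a₂ ↮ {a₁, o}`
(`TypeRB.bhk_other_cluster_avoid`). -/
theorem iExprD_nonneg_of_a3_eq_o (p : E → R) (hp : IsProbVec p) (ends : E → Sym2 V)
    (o a₁ a₂ b : V) (c₀ c₁ : R) (hc₀ : 0 ≤ c₀) : 0 ≤ iExprD p ends o a₁ a₂ o b c₀ c₁ := by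
  rw [iExprD_eq]
  have hz : ∀ X : Set (Config E), X ⊆ connEvent ends a₁ o ∩ connEvent ends a₂ o ∩
      (connEvent ends a₁ a₂)ᶜ → prob p X = 0 := by
    intro X hX
    have : X = ∅ := by
      ext ω
      simp only [Set.mem_empty_iff_false, iff_false]
      intro hω
      obtain ⟨⟨h1, h2⟩, h3⟩ := hX hω
      exact h3 (conn_trans h1 (conn_symm h2))
    rw [this, prob_empty]
  rw [hz (connEvent ends a₁ b ∩ connEvent ends a₁ o ∩ connEvent ends a₂ o ∩
      (connEvent ends a₁ a₂)ᶜ) (fun _ h => ⟨⟨h.1.1.2, h.1.2⟩, h.2⟩),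
    hz (connEvent ends a₁ o ∩ connEvent ends a₂ o ∩ (connEvent ends a₁ a₂)ᶜ) (fun _ h => h)]
  have hbhk := TypeRB.bhk_other_cluster_avoid p ends hp a₂ a₁ (X := ({a₁, o} : Finset V)) (by simp)
    (isUpperSet_mem_setOf b) (isUpperSet_mem_setOf o)
  rw [← connEvent_eq_clusterInEvent ends a₁ b, ← connEvent_eq_clusterInEvent ends a₁ o,
    ← Dw_eq_avoidAll, B₁A_inter_Dw, A_inter_Dw] at hbhk
  have key : 0 ≤ prob p (Dw ends a₁ a₂ o) *
      prob p (connEvent ends a₁ b ∩ connEvent ends a₁ o ∩ (connEvent ends a₁ a₂)ᶜ) -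
      prob p (connEvent ends a₁ b ∩ Dw ends a₁ a₂ o) *
        prob p (connEvent ends a₁ o ∩ (connEvent ends a₁ a₂)ᶜ) := by linarith [hbhk]
  have := mul_nonneg hc₀ key
  linarith [this]

end Theorem

/-! ## Roots and one further vertex -/

section RootsAndLeaf
variable {V : Type*} {E : Type*} [Fintype E] [DecidableEq E] [Fintype V] [DecidableEq V]
  {R : Type*} [Field R] [LinearOrder R] [IsStrictOrderedRing R]
variable {ends : E → Sym2 V} {a₁ a₂ a₃ : V} {e₀ : E}

/-- **Roots and one further vertex, D-world form**: if every edge at `a₃` other than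
`e₀ = {v, a₃}` joins a root, then `ZSplitID` of `a₃` follows from the D-world `(i)` of `v` in
`G − a₃` at the PD pair of `a₃`, for every admissible weight vector with the root edges at `a₃`
null. -/
theorem zSplitID_of_rootsAndLeaf (p : E → R) (hp : IsProbVec p) {v : V} (he₀ : ends e₀ = s(v, a₃))
    (hroot : ∀ e, a₃ ∈ ends e → e ≠ e₀ → ends e = s(a₁, a₃) ∨ ends e = s(a₂, a₃)) (hv : v ≠ a₃)
    {o b : V} (ho : o ≠ a₃) (h1 : a₁ ≠ a₃) (h2 : a₂ ≠ a₃) (hb : b ≠ a₃)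
    (base : ∀ p' : E → R, IsProbVec p' → (∀ e, a₃ ∈ ends e → e ≠ e₀ → p' e = 0) →
      0 ≤ iExprD (Function.update p' e₀ 0) ends o a₁ a₂ v b (Dpdo p' ends o a₁ a₂ a₃)
        (Dpd p' ends a₁ a₂ a₃)) :
    ZSplitID p ends o a₁ a₂ a₃ b := by
  refine zSplitID_of_rootFree p hp o b fun p' hp' hnull => ?_
  have hnull' : ∀ e, a₃ ∈ ends e → e ≠ e₀ → p' e = 0 := fun e he hne => hnull e (hroot e he hne)
  exact zSplitID_of_leaf_supp hp' ⟨he₀, hnull', hv⟩ ho h1 h2 hb (base p' hp' hnull')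

/-- **`(i)` for `a₃` adjacent to the roots (any multiplicities) and to `b`** through `e₀`, every
finite graph, every weight vector. -/
theorem zSplitI_of_rootsAndB (p : E → R) (hp : IsProbVec p) {b : V} (he₀ : ends e₀ = s(b, a₃))
    (hroot : ∀ e, a₃ ∈ ends e → e ≠ e₀ → ends e = s(a₁, a₃) ∨ ends e = s(a₂, a₃)) (hb : b ≠ a₃)
    (h1 : a₁ ≠ a₃) (h2 : a₂ ≠ a₃) {o : V} (ho : o ≠ a₃) : ZSplitI p ends o a₁ a₂ a₃ b := by
  refine zSplitI_of_dworld p hp ends o a₁ a₂ a₃ b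
    (zSplitID_of_rootsAndLeaf p hp he₀ hroot hb ho h1 h2 hb fun p' hp' hnull => ?_)
  have hl : IsLeafSupp p' ends b a₃ e₀ := ⟨he₀, hnull, hb⟩
  have hp'' : IsProbVec (Function.update p' e₀ 0) := hp'.update e₀ le_rfl zero_le_one
  refine iExprD_nonneg_of_a3_eq_b _ hp'' ends o a₁ a₂ b _ _ ?_
  rw [Dpd_leaf_supp hl h1 h2, Dpdo_leaf_supp hl ho h1 h2]
  exact odds_mix (Function.update p' e₀ 0) hp'' ends o a₁ a₂ b (p' e₀) (hp'.nonneg e₀)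
    (hp'.le_one e₀)

/-- **`(J1₁)` for `a₃` adjacent to the roots (any multiplicities) and to `b`.** -/
theorem jOneOne_of_rootsAndB (p : E → R) (hp : IsProbVec p) {b : V} (he₀ : ends e₀ = s(b, a₃))
    (hroot : ∀ e, a₃ ∈ ends e → e ≠ e₀ → ends e = s(a₁, a₃) ∨ ends e = s(a₂, a₃)) (hb : b ≠ a₃)
    (h1 : a₁ ≠ a₃) (h2 : a₂ ≠ a₃) {o : V} (ho : o ≠ a₃) : JOneOne p ends o a₁ a₂ a₃ b :=
  jOneOne_of_i_of_ii p ends o a₁ a₂ a₃ b (zSplitI_of_rootsAndB p hp he₀ hroot hb h1 h2 ho)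
    (zSplitII_of_rootsAndB p hp he₀ hroot hb h1 h2 ho)

end RootsAndLeaf

/-! ## Theorem D2 for `(i)` -/

section DegTwo
variable {V : Type*} {E : Type*} [Fintype E] [DecidableEq E] [Fintype V] [DecidableEq V]
  {R : Type*} [Field R] [LinearOrder R] [IsStrictOrderedRing R]
variable {p : E → R} {ends : E → Sym2 V} {a₁ v a₃ : V} {e₁ e₀ : E}

/-- **Theorem D2 for `(i)`, D-world form**: the D-world `(i)` of `v` in `G − a₃` (weights
`p[e₁ ↦ 0][e₀ ↦ 0]`) at the PD pair of `a₃` gives the D-world `(i)` of `a₃`. -/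
theorem zSplitID_of_degTwo (hp : IsProbVec p) (h : IsDegTwoAt ends a₁ v a₃ e₁ e₀) {o a₂ b : V}
    (ho : o ≠ a₃) (h2 : a₂ ≠ a₃) (hb : b ≠ a₃)
    (hv : 0 ≤ iExprD (Function.update (Function.update p e₁ 0) e₀ 0) ends o a₁ a₂ v b
      (Dpdo p ends o a₁ a₂ a₃) (Dpd p ends a₁ a₂ a₃)) :
    ZSplitID p ends o a₁ a₂ a₃ b := by
  have hp0 : IsProbVec (Function.update p e₁ 0) := hp.update e₁ le_rfl zero_le_one
  have hl := isLeafSupp_of_degTwo p h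
  rw [Dpd_a1_edge p h.ends₁, Dpdo_a1_edge p h.ends₁ o, iExprD_smul] at hv
  rcases (sub_nonneg.mpr (hp.le_one e₁)).lt_or_eq with hlt | heq
  · have hv' := nonneg_of_mul_nonneg_right hv hlt
    exact zSplitID_of_a1_edge p hp h.ends₁ o b (zSplitID_of_leaf_supp hp0 hl ho h.ne_1 h2 hb hv')
  · unfold ZSplitID
    rw [Dpd_a1_edge p h.ends₁, Dpdo_a1_edge p h.ends₁ o, ← heq, zero_mul, zero_mul, iExprD_eq]
    simp

/-- **Theorem D2 for `(i)`**: `(i)` for a degree-two `a₃` adjacent to `a₁` and `v`, from the D-world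
`(i)` of `v` in `G − a₃` at the PD pair of `a₃`. -/
theorem zSplitI_of_degTwo (hp : IsProbVec p) (h : IsDegTwoAt ends a₁ v a₃ e₁ e₀) {o a₂ b : V}
    (ho : o ≠ a₃) (h2 : a₂ ≠ a₃) (hb : b ≠ a₃)
    (hv : 0 ≤ iExprD (Function.update (Function.update p e₁ 0) e₀ 0) ends o a₁ a₂ v b
      (Dpdo p ends o a₁ a₂ a₃) (Dpd p ends a₁ a₂ a₃)) :
    ZSplitI p ends o a₁ a₂ a₃ b :=
  zSplitI_of_dworld p hp ends o a₁ a₂ a₃ b (zSplitID_of_degTwo hp h ho h2 hb hv)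

/-- **`(i)` for `a₃` adjacent only to `a₁` and `o`** (unconditional). -/
theorem zSplitI_of_degTwo_o (hp : IsProbVec p) {o : V} (h : IsDegTwoAt ends a₁ o a₃ e₁ e₀)
    {a₂ b : V} (h2 : a₂ ≠ a₃) (hb : b ≠ a₃) : ZSplitI p ends o a₁ a₂ a₃ b :=
  zSplitI_of_degTwo hp h h.ne_v h2 hb
    (iExprD_nonneg_of_a3_eq_o _ ((hp.update e₁ le_rfl zero_le_one).update e₀ le_rfl zero_le_one)
      ends o a₁ a₂ b _ _ (prob_nonneg hp _))

/-- **`(i)` for `a₃` adjacent only to `a₁` and `b`** (unconditional). -/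
theorem zSplitI_of_degTwo_b (hp : IsProbVec p) {b : V} (h : IsDegTwoAt ends a₁ b a₃ e₁ e₀)
    {o a₂ : V} (ho : o ≠ a₃) (h2 : a₂ ≠ a₃) : ZSplitI p ends o a₁ a₂ a₃ b := by
  refine zSplitI_of_degTwo hp h ho h2 h.ne_v ?_
  have hp0 : IsProbVec (Function.update p e₁ 0) := hp.update e₁ le_rfl zero_le_one
  have hp00 : IsProbVec (Function.update (Function.update p e₁ 0) e₀ 0) :=
    hp0.update e₀ le_rfl zero_le_one
  have hl := isLeafSupp_of_degTwo p h
  refine iExprD_nonneg_of_a3_eq_b _ hp00 ends o a₁ a₂ b _ _ ?_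
  rw [Dpd_a1_edge p h.ends₁, Dpdo_a1_edge p h.ends₁ o, Dpd_leaf_supp hl h.ne_1 h2,
    Dpdo_leaf_supp hl ho h.ne_1 h2]
  have hq := odds_mix (Function.update (Function.update p e₁ 0) e₀ 0) hp00 ends o a₁ a₂ b
    ((Function.update p e₁ 0) e₀) (hp0.nonneg e₀) (hp0.le_one e₀)
  have h1 : 0 ≤ 1 - p e₁ := by linarith [hp.le_one e₁]
  have := mul_le_mul_of_nonneg_left hq h1
  linarith [this]

/-- **`(J1₁)` for `a₃` adjacent only to `a₁` and `o`.** -/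
theorem jOneOne_of_degTwo_o (hp : IsProbVec p) {o : V} (h : IsDegTwoAt ends a₁ o a₃ e₁ e₀)
    {a₂ b : V} (h2 : a₂ ≠ a₃) (hb : b ≠ a₃) : JOneOne p ends o a₁ a₂ a₃ b :=
  jOneOne_of_i_of_ii p ends o a₁ a₂ a₃ b (zSplitI_of_degTwo_o hp h h2 hb)
    (zSplitII_of_degTwo_o hp h h2 hb)

/-- **`(J1₁)` for `a₃` adjacent only to `a₁` and `b`.** -/
theorem jOneOne_of_degTwo_b (hp : IsProbVec p) {b : V} (h : IsDegTwoAt ends a₁ b a₃ e₁ e₀)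
    {o a₂ : V} (ho : o ≠ a₃) (h2 : a₂ ≠ a₃) : JOneOne p ends o a₁ a₂ a₃ b :=
  jOneOne_of_i_of_ii p ends o a₁ a₂ a₃ b (zSplitI_of_degTwo_b hp h ho h2)
    (zSplitII_of_degTwo_b hp h ho h2)

end DegTwo

end CaseOne

end Summit.Ventures.PercRepro2
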